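import Literature.Topology.FourManifolds.ConnectedSum
import HarnessLib

/-!
# Uniqueness of open gluings of smooth manifolds (Kosinski VI.1)

Companion to `Literature.Topology.FourManifolds.ConnectedSum` (`Literature.Topology.FourManifolds.IsOpenGluing`).

Kosinski (*Differential Manifolds*, Ch. VI §1, proof of Theorem (1.1)) equips the identification
space `A ∪_g B` of two manifolds along a diffeomorphism `g` of open subsets with "the unique
structure for which the projections `A → A ∪_g B`, `B → A ∪_g B` are diffeomorphisms" onto their
(open) images. In the relational language of `IsOpenGluing` this uniqueness reads: two open
gluings `P`, `P'` of the same pieces `A`, `B` along the same relation `R` are diffeomorphic, via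
`jA a ↦ jA' a`, `jB b ↦ jB' b` (`IsOpenGluing.nonempty_diffeomorph`). The smoothness of this
comparison map is the *descent of smoothness along an open immersion*
(`contMDiffAt_of_comp_isImmersionAt`): if `j : A → P` is a `C^n` immersion at `a` and an open
map, and `f ∘ j = g` is `C^n` at `a`, then `f` is `C^n` at `j a` — in the immersion charts
`j` reads `u ↦ e (u, 0)` for a linear isomorphism `e`, so `f` reads `g ∘ pr₁ ∘ e⁻¹` on the
(relatively open) image of `j`.

## Main results (all proved)

* `Literature.Topology.FourManifolds.contMDiffAt_of_comp_isImmersionAt`: descent of `C^n`-smoothness along an open immersion.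
* `Literature.Topology.FourManifolds.IsOpenGluing.exists_map_apply_eq`: the set-theoretic comparison map between two gluings.
* `Literature.Topology.FourManifolds.IsOpenGluing.contMDiff_of_comp_eq`: it is smooth.
* `Literature.Topology.FourManifolds.IsOpenGluing.nonempty_diffeomorph`: **uniqueness of open gluings** — two open gluings of
  the same pieces along the same relation are diffeomorphic. Used to discharge
  `Literature.Topology.FourManifolds.nonempty_diffeomorph_of_isMappingTorusOf` (`MappingTorusProofs.lean`).

Mathlib status: `Manifold.IsImmersionAt` provides the slice charts (`domChart`, `codChart`,
`equiv`, `writtenInCharts`) and `ContMDiffAt.iff_comp_isImmersionAt` (smoothness tested after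
*post*-composition with an immersion); the *pre*-composition/descent statement proved here is not
in Mathlib (`rg "IsOpenMap" Mathlib/Geometry/Manifold/Immersion.lean`: nothing).

Sources: A. Kosinski, *Differential Manifolds* (1993), Ch. VI §1, Theorem (1.1) and its proof;
M. Kervaire, J. Milnor, *Groups of homotopy spheres I*, Ann. of Math. 77 (1963), §2.
-/

open scoped Manifold ContDiff Topology
open Set

noncomputable section

namespace Literature.Topology.FourManifolds

section Descent

variable {𝕜 : Type*} [NontriviallyNormedField 𝕜]
  {EA EP EQ : Type*} [NormedAddCommGroup EA] [NormedSpace 𝕜 EA]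
  [NormedAddCommGroup EP] [NormedSpace 𝕜 EP] [NormedAddCommGroup EQ] [NormedSpace 𝕜 EQ]
  {HA HP HQ : Type*} [TopologicalSpace HA] [TopologicalSpace HP] [TopologicalSpace HQ]
  {IA : ModelWithCorners 𝕜 EA HA} {IP : ModelWithCorners 𝕜 EP HP} {IQ : ModelWithCorners 𝕜 EQ HQ}
  {A P Q : Type*} [TopologicalSpace A] [ChartedSpace HA A] [TopologicalSpace P]
  [ChartedSpace HP P] [TopologicalSpace Q] [ChartedSpace HQ Q] {n : ℕ∞ω}

open Function in
/-- **Descent of smoothness along an open immersion.** Let `j : A → P` be a `C^n` immersion at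
`a` which is an open map (e.g. an open smooth embedding), and let `f : P → Q` be a map whose
composite `f ∘ j = g` is `C^n` at `a`. Then `f` is `C^n` at `j a`. Proof: in the charts `φ`, `ψ`
of the immersion, `ψ ∘ j ∘ φ⁻¹ = e ∘ (·, 0)` for a continuous linear isomorphism
`e : EA × F ≃ EP`, so on the image `ψ (j (φ.source))` — a neighbourhood of `ψ (j a)` within
`range IP`, `j` being open — `f` reads `(χ ∘ g ∘ φ⁻¹) ∘ pr₁ ∘ e⁻¹`, a composite of `C^n` maps.
This is the smoothness half of Kosinski's remark that the smooth structure on an identification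
space is "the unique structure for which the projections are diffeomorphisms" onto their images
(Kosinski, *Differential Manifolds*, VI.1, proof of (1.1); cf. I.(1.5), (1.6)). [cite: Kosinski1993, Ch. VI §1, proof of Thm (1.1)] -/
theorem contMDiffAt_of_comp_isImmersionAt [IsManifold IQ n Q] {j : A → P} {g : A → Q}
    {f : P → Q} {a : A} (hj : Manifold.IsImmersionAt IA IP n j a) (hjo : IsOpenMap j)
    (hg : ContMDiffAt IA IQ n g a) (hfg : ∀ a', f (j a') = g a') :
    ContMDiffAt IP IQ n f (j a) := by
  -- `f` is continuous at `j a`, since `j` is open and `f ∘ j = g` is continuous at `a`.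
  have hcont : ContinuousAt f (j a) := by
    rw [ContinuousAt, hfg]
    intro V hV
    refine Filter.mem_map.2 (Filter.mem_of_superset (hjo.image_mem_nhds (hg.continuousAt hV)) ?_)
    rintro _ ⟨a', ha', rfl⟩
    show f (j a') ∈ V
    rw [hfg]
    exact ha'
  let φ := hj.domChart
  let ψ := hj.codChart
  let s : Set P := j '' φ.source
  have hs : s ∈ 𝓝 (j a) := hjo.image_mem_nhds (φ.open_source.mem_nhds hj.mem_domChart_source)
  suffices h : ContMDiffWithinAt IP IQ n f s (j a) from h.contMDiffAt hs
  have hsψ : s ⊆ ψ.source := by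
    rintro _ ⟨a', ha', rfl⟩
    exact hj.source_subset_preimage_source ha'
  have hga : f (j a) = g a := hfg a
  rw [contMDiffWithinAt_iff_image hj.codChart_mem_maximalAtlas
    (IsManifold.chart_mem_maximalAtlas (g a)) hsψ hj.mem_codChart_source
    (by rw [hga]; exact mem_chart_source HQ (g a))]
  refine ⟨hcont.continuousWithinAt, ?_⟩
  -- In the immersion charts, `ψ (j a') = e (φ a', 0)`.
  have key : ∀ a' ∈ φ.source, ψ.extend IP (j a') = hj.equiv (φ.extend IA a', 0) := by
    intro a' ha'
    have h1 : φ.extend IA a' ∈ (φ.extend IA).target :=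
      (φ.extend IA).map_source (by rw [φ.extend_source]; exact ha')
    have h2 := hj.writtenInCharts h1
    rw [comp_apply, comp_apply, φ.extend_left_inv ha'] at h2
    exact h2
  -- `g` read in the charts `φ`, `chartAt (g a)` is `C^n` within `range IA`.
  have hG : ContDiffWithinAt 𝕜 n ((chartAt HQ (g a)).extend IQ ∘ g ∘ (φ.extend IA).symm)
      (range IA) (φ.extend IA a) :=
    ((contMDiffAt_iff_of_mem_maximalAtlas hj.domChart_mem_maximalAtlas
      (IsManifold.chart_mem_maximalAtlas (g a)) hj.mem_domChart_source
      (mem_chart_source HQ (g a))).1 hg).2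
  -- The left inverse `pr₁ ∘ e⁻¹` of `u ↦ e (u, 0)` is smooth.
  have hπ : ContDiffWithinAt 𝕜 n (Prod.fst ∘ (hj.equiv.symm : EP → EA × hj.complement))
      (ψ.extend IP '' s) (ψ.extend IP (j a)) :=
    (contDiffAt_fst.comp _ hj.equiv.symm.contDiff.contDiffAt).contDiffWithinAt
  have hπa : (Prod.fst ∘ (hj.equiv.symm : EP → EA × hj.complement)) (ψ.extend IP (j a)) =
      φ.extend IA a := by
    rw [comp_apply, key a hj.mem_domChart_source, ContinuousLinearEquiv.symm_apply_apply]
  have hcomp := ContDiffWithinAt.comp (ψ.extend IP (j a)) (hπa ▸ hG) hπ ?_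
  · refine hcomp.congr_of_mem ?_
      (mem_image_of_mem _ (mem_image_of_mem _ hj.mem_domChart_source))
    rintro _ ⟨_, ⟨a', ha', rfl⟩, rfl⟩
    simp only [comp_apply, key a' ha', ContinuousLinearEquiv.symm_apply_apply,
      φ.extend_left_inv ha']
    rw [← key a' ha', ψ.extend_left_inv (hj.source_subset_preimage_source ha'), hfg]
  · rintro _ ⟨_, ⟨a', ha', rfl⟩, rfl⟩
    simp only [comp_apply, key a' ha', ContinuousLinearEquiv.symm_apply_apply]
    exact ⟨φ a', rfl⟩

end Descent

section GlueMap

variable {A B P P' : Type*} {jA : A → P} {jB : B → P} {jA' : A → P'} {jB' : B → P'}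

/-- **The comparison map between two gluings**, set-theoretic part. If `P = jA(A) ∪ jB(B)` with
`jA`, `jB` injective, and `jA' : A → P'`, `jB' : B → P'` respect the identifications of `P`
(`jA a = jB b → jA' a = jB' b`), then `jA a ↦ jA' a`, `jB b ↦ jB' b` is a well defined map
`P → P'`. This is the map `G` of Kosinski, *Differential Manifolds*, VI.1, proof of (1.1),
(***), with `g = id`. [cite: Kosinski1993, Ch. VI §1, proof of Thm (1.1)] -/
theorem IsOpenGluing.exists_map_apply_eq (hU : range jA ∪ range jB = univ)
    (hinjA : Function.Injective jA) (hinjB : Function.Injective jB)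
    (hR : ∀ a b, jA a = jB b → jA' a = jB' b) :
    ∃ G : P → P', (∀ a, G (jA a) = jA' a) ∧ ∀ b, G (jB b) = jB' b := by
  classical
  refine ⟨fun p => if h : p ∈ range jA then jA' (Classical.choose h)
    else jB' (Classical.choose ((eq_univ_iff_forall.1 hU p).resolve_left h)),
    fun a => ?_, fun b => ?_⟩
  · dsimp only
    rw [dif_pos (mem_range_self a)]
    exact congrArg jA' (hinjA (Classical.choose_spec (mem_range_self (f := jA) a)))
  · dsimp only
    by_cases h : jB b ∈ range jA
    · rw [dif_pos h]
      exact hR _ _ (Classical.choose_spec h)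
    · rw [dif_neg h]
      exact congrArg jB' (hinjB (Classical.choose_spec
        ((eq_univ_iff_forall.1 hU (jB b)).resolve_left h)))

end GlueMap

section GluingUnique

variable {EA HA EB HB EP HP HP' : Type*}
  [NormedAddCommGroup EA] [NormedSpace ℝ EA] [TopologicalSpace HA] {IA : ModelWithCorners ℝ EA HA}
  [NormedAddCommGroup EB] [NormedSpace ℝ EB] [TopologicalSpace HB] {IB : ModelWithCorners ℝ EB HB}
  [NormedAddCommGroup EP] [NormedSpace ℝ EP] [TopologicalSpace HP] {IP : ModelWithCorners ℝ EP HP}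
  [TopologicalSpace HP'] {IP' : ModelWithCorners ℝ EP HP'}
  {A B P P' : Type*} [TopologicalSpace A] [ChartedSpace HA A] [TopologicalSpace B]
  [ChartedSpace HB B]
  [TopologicalSpace P] [ChartedSpace HP P] [TopologicalSpace P'] [ChartedSpace HP' P']
  {jA : A → P} {jB : B → P} {jA' : A → P'} {jB' : B → P'}

/-- The comparison map `G : P → P'` between an open gluing `P = jA(A) ∪ jB(B)` (open smooth
embeddings covering `P`) and smooth maps `jA' = G ∘ jA : A → P'`, `jB' = G ∘ jB : B → P'` is
smooth: locally it is `jA' ∘ jA⁻¹` or `jB' ∘ jB⁻¹` (`contMDiffAt_of_comp_isImmersionAt`)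
(Kosinski, *Differential Manifolds*, VI.1, proof of (1.1): "the unique structure for which the
projections are diffeomorphisms"). [cite: Kosinski1993, Ch. VI §1, proof of Thm (1.1)] -/
theorem IsOpenGluing.contMDiff_of_comp_eq [IsManifold IP' ∞ P']
    (hA : Manifold.IsSmoothEmbedding IA IP ∞ jA) (hAo : IsOpen (range jA))
    (hB : Manifold.IsSmoothEmbedding IB IP ∞ jB) (hBo : IsOpen (range jB))
    (hU : range jA ∪ range jB = univ) (hA' : ContMDiff IA IP' ∞ jA') (hB' : ContMDiff IB IP' ∞ jB')
    {G : P → P'} (hGA : ∀ a, G (jA a) = jA' a) (hGB : ∀ b, G (jB b) = jB' b) :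
    ContMDiff IP IP' ∞ G := by
  intro p
  rcases (eq_univ_iff_forall.1 hU p) with ⟨a, rfl⟩ | ⟨b, rfl⟩
  · exact contMDiffAt_of_comp_isImmersionAt (hA.isImmersion.isImmersionAt a)
      (Topology.IsOpenEmbedding.isOpenMap ⟨hA.isEmbedding, hAo⟩) (hA' a) hGA
  · exact contMDiffAt_of_comp_isImmersionAt (hB.isImmersion.isImmersionAt b)
      (Topology.IsOpenEmbedding.isOpenMap ⟨hB.isEmbedding, hBo⟩) (hB' b) hGB

/-- **Uniqueness of open gluings.** Two open gluings `P`, `P'` of the same manifolds `A`, `B`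
along the same relation `R` are diffeomorphic: the comparison maps `jA a ↦ jA' a, jB b ↦ jB' b`
(`IsOpenGluing.exists_map_apply_eq`) and its analogue in the other direction are mutually inverse
and smooth (`IsOpenGluing.contMDiff_of_comp_eq`). This is Kosinski's uniqueness of the smooth
structure on an identification space `A ∪_g B`, "the unique structure for which the projections
are diffeomorphisms" onto their open images (Kosinski, *Differential Manifolds*, Ch. VI §1, proof
of Theorem (1.1); Kervaire–Milnor 1963, §2). Only `P`, `P'` need to be `C^∞` manifolds (so that
their preferred charts lie in the maximal atlases); no hypothesis on `A`, `B` is needed. [cite: Kosinski1993, Ch. VI §1, proof of Thm (1.1)] -/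
theorem IsOpenGluing.nonempty_diffeomorph [IsManifold IP ∞ P] [IsManifold IP' ∞ P']
    {R : A → B → Prop} (h : IsOpenGluing IA IB IP (P := P) R)
    (h' : IsOpenGluing IA IB IP' (P := P') R) : Nonempty (P ≃ₘ⟮IP, IP'⟯ P') := by
  obtain ⟨jA, jB, hA, hAo, hB, hBo, hU, hR⟩ := h
  obtain ⟨jA', jB', hA', hAo', hB', hBo', hU', hR'⟩ := h'
  have hRR' : ∀ a b, jA a = jB b → jA' a = jB' b := fun a b hab => (hR' a b).2 ((hR a b).1 hab)
  have hR'R : ∀ a b, jA' a = jB' b → jA a = jB b := fun a b hab => (hR a b).2 ((hR' a b).1 hab)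
  obtain ⟨G, hGA, hGB⟩ := IsOpenGluing.exists_map_apply_eq hU hA.isEmbedding.injective
    hB.isEmbedding.injective hRR'
  obtain ⟨G', hGA', hGB'⟩ := IsOpenGluing.exists_map_apply_eq hU' hA'.isEmbedding.injective
    hB'.isEmbedding.injective hR'R
  refine ⟨{ toFun := G
            invFun := G'
            left_inv := fun p => ?_
            right_inv := fun p => ?_
            contMDiff_toFun := IsOpenGluing.contMDiff_of_comp_eq hA hAo hB hBo hU hA'.contMDiff
              hB'.contMDiff hGA hGB
            contMDiff_invFun := IsOpenGluing.contMDiff_of_comp_eq hA' hAo' hB' hBo' hU'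
              hA.contMDiff hB.contMDiff hGA' hGB' }⟩
  · rcases eq_univ_iff_forall.1 hU p with ⟨a, rfl⟩ | ⟨b, rfl⟩
    · rw [hGA, hGA']
    · rw [hGB, hGB']
  · rcases eq_univ_iff_forall.1 hU' p with ⟨a, rfl⟩ | ⟨b, rfl⟩
    · rw [hGA', hGA]
    · rw [hGB', hGB]

end GluingUnique

end Literature.Topology.FourManifolds
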